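import Mathlib
import Summits.AtomisticToContinuum.FouriersLaw.Theses.EmbeddedDrudeMourre
import Summits.AtomisticToContinuum.FouriersLaw.Theorems.EmbeddedDrudeMourreMourreDissolutionFermiGoldenRuleThreshold
import Summits.AtomisticToContinuum.FouriersLaw.Theorems.EmbeddedDrudeMourreMourreDissolutionLevelShiftPushforward
import Literature.Analysis.SpecialFunctions.BesselJZeroFermiIntegral
import HarnessLib

/-!
# Stub B `stub_freeOddExcursionKernel` of line `kinetic-polymer-gas-on-the-time-axis`:
# THE FERMI-GOLDEN-RULE IDENTITY IS A THEOREM — only the `L¹` clause remains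
(crux `EmbeddedDrudeMourre.DrudeDissolution`, item stmt-AtomisticToContinuum-12593; `--supports` file,
closes nothing; lead c11)

Stub B of the checked skeleton `Cruxes/DrudeDissolution/Lines/kinetic_polymer_gas_on_the_time_axis.lean`
asks, for `ω₂ > 0`, couplings `a, b` and a sine polynomial `f`, for TWO things about the free odd
excursion kernel
`F_f(t) = ∫_{(−π,π]³} Φ²·[f]²·(ω₁ω₂ω₃ω₄)⁻²·cos(tΩ) dk`
(`Φ = vertex a b`, `[f] = f₁ + f₂ − f₃ − f₄`, `Ω = resonanceFn ω₂`):
(1) `F_f ∈ L¹(0,∞)` (dispersive decay — multidimensional stationary phase on the 3-torus with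
degenerate co-moving critical manifolds; TRUE, size XL, NOT done here), and
(2) the Fermi-golden-rule identity `∫₀^∞ F_f = (64π²/9)·q_{ω₂,a,b}(f)` (`q = boltzmannForm`).

This file proves (2) GIVEN (1), and proves UNCONDITIONALLY its Abelian form

  `∫₀^∞ e^{−νt} F_f(t) dt ⟶ (64π²/9)·q(f)`  as `ν ↓ 0`

(`tendsto_abel_freeOddExcursionKernel`), for every `2π`-periodic `C²` profile `f`. Mechanism: for
`ν > 0`, Fubini and `∫₀^∞ e^{−νt}cos(tΩ)dt = ν/(ν² + Ω²)` turn the Abel mean into the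
Poisson-regularised bracket-weighted pair spectral function `R_f(ν, 0)` of the sibling crux
stmt-12594 (line `swap-odd-threshold-rigidity`), whose threshold limit
`R_f(ν,0) → (4π/alsPrefactor)·q(f)` is the LANDED `MourreDissolution.fermiGoldenRule_threshold`
(`4π/alsPrefactor = 64π²/9` since `alsPrefactor = 9/(16π)`); the Fin-3 box integral of stub B is
transported to the sibling's iterated integral `dk₁ dk₃ dk₂` by the volume-preserving reindexing
`k ↦ (k 0, (k 2, k 1))` (`fgr_setIntegral_cell_eq`). Given (1), dominated convergence (`e^{−νt} ↑ 1`) and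
uniqueness of limits along `𝓝[>] 0` give (2). The last theorem
`stub_freeOddExcursionKernel_of_integrable` is the reshaped-stub glue: hypothesis = clause (1) for all
data, conclusion = stub B verbatim.
-/

noncomputable section

open MeasureTheory Filter Set Function Topology Real
open scoped ENNReal NNReal Topology
open Literature.MathematicalPhysics.KineticTheory
open Literature.MathematicalPhysics.KineticTheory.PhononBoltzmann

namespace Summit.AtomisticToContinuum.FouriersLaw.Theorems.DrudeDissolution.KineticPolymerGasOnTheTimeAxis

/-! ### §1 The cell `(−π,π]³`: Fin-3 box integrals as iterated product integrals -/

/-- **Box integral = product integral.** For any `G : ℝ³ → ℝ` and any `s ⊆ ℝ`,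
`∫_{k ∈ Π s} G(k 0, k 2, k 1) dk = ∫ G d((vol|s) ⊗ ((vol|s) ⊗ (vol|s)))`: the reindexing
`k ↦ (k 0, (k 2, k 1))` of `Fin 3 → ℝ` onto `ℝ × ℝ × ℝ` (the variable order `(k₁, (k₃, k₂))` of the
sibling crux's cell integrals) is a volume-preserving measurable equivalence pulling the cube
`s × (s × s)` back to the box `Π_{i<3} s`. [folklore] -/
theorem fgr_setIntegral_cell_eq (G : ℝ × ℝ × ℝ → ℝ) (s : Set ℝ) :
    ∫ k in Set.pi Set.univ (fun _ : Fin 3 => s), G (k 0, k 2, k 1) =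
      ∫ p, G p ∂((volume.restrict s).prod ((volume.restrict s).prod (volume.restrict s))) := by
  let e : (Fin 3 → ℝ) ≃ᵐ ℝ × ℝ × ℝ :=
    (MeasurableEquiv.piFinSuccAbove (fun _ : Fin 3 => ℝ) 0).trans
      (MeasurableEquiv.prodCongr (MeasurableEquiv.refl ℝ)
        (MeasurableEquiv.finTwoArrow.trans MeasurableEquiv.prodComm))
  have he : ∀ k : Fin 3 → ℝ, e k = (k 0, k 2, k 1) := fun k => rfl
  have hvol : MeasurePreserving e volume volume :=
    (MeasureTheory.volume_preserving_piFinSuccAbove (fun _ : Fin 3 => ℝ) 0).trans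
      ((MeasurePreserving.id volume).prod
        ((MeasureTheory.volume_preserving_finTwoArrow ℝ).trans
          (MeasureTheory.Measure.measurePreserving_swap)))
  have hpre : e ⁻¹' (s ×ˢ (s ×ˢ s)) = Set.pi Set.univ (fun _ : Fin 3 => s) := by
    ext k
    simp only [mem_preimage, he, mem_prod, mem_univ_pi]
    constructor
    · rintro ⟨h0, h2, h1⟩ i
      fin_cases i <;> assumption
    · intro h
      exact ⟨h 0, h 2, h 1⟩
  rw [Measure.prod_restrict, Measure.prod_restrict, ← hpre]
  have h := hvol.setIntegral_preimage_emb e.measurableEmbedding G (s ×ˢ (s ×ˢ s))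
  simp only [he] at h
  exact h.trans rfl

/-- The box `(−π,π]³ ⊂ ℝ³` (as `Fin 3 → ℝ`) has finite Lebesgue measure. [folklore] -/
theorem fgr_volume_cell_lt_top :
    volume (Set.pi Set.univ (fun _ : Fin 3 => Set.Ioc (-Real.pi) Real.pi)) < ⊤ := by
  refine lt_of_le_of_lt (measure_mono (Set.pi_mono fun _ _ => Set.Ioc_subset_Icc_self)) ?_
  exact (isCompact_univ_pi fun _ => isCompact_Icc).measure_lt_top

/-- A continuous function on `Fin 3 → ℝ` is integrable on the box `(−π,π]³`. [folklore] -/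
theorem fgr_integrableOn_cell {W : (Fin 3 → ℝ) → ℝ} (hW : Continuous W) :
    IntegrableOn W (Set.pi Set.univ (fun _ : Fin 3 => Set.Ioc (-Real.pi) Real.pi)) :=
  ((hW.continuousOn.integrableOn_compact (isCompact_univ_pi fun _ => isCompact_Icc)).mono_set
    (Set.pi_mono fun _ _ => Set.Ioc_subset_Icc_self))

/-! ### §2 Fubini: the Abel mean of the kernel is the Poisson-regularised pair spectral function -/

/-- **Laplace transform of an oscillatory box integral.** For `ν > 0`, continuous `W, Ω` on
`Fin 3 → ℝ`: `∫_{t>0} e^{−νt} (∫_cell W(k) cos(tΩ(k)) dk) dt = ∫_cell W(k)·ν/(ν² + Ω(k)²) dk`.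
[folklore] -/
theorem fgr_abel_eq_poisson {W Ω : (Fin 3 → ℝ) → ℝ} (hW : Continuous W) (hΩ : Continuous Ω)
    {ν : ℝ} (hν : 0 < ν) :
    ∫ t in Ioi (0 : ℝ), Real.exp (-(ν * t)) *
        ∫ k in Set.pi Set.univ (fun _ : Fin 3 => Set.Ioc (-Real.pi) Real.pi), W k * Real.cos (t * Ω k) =
      ∫ k in Set.pi Set.univ (fun _ : Fin 3 => Set.Ioc (-Real.pi) Real.pi), W k * (ν / (ν ^ 2 + Ω k ^ 2)) := by
  set cell : Set (Fin 3 → ℝ) := Set.pi Set.univ (fun _ : Fin 3 => Set.Ioc (-Real.pi) Real.pi) with hcell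
  -- integrability of the joint integrand on `(0,∞) × cell`
  have hexp : Integrable (fun t : ℝ => Real.exp (-(ν * t))) (volume.restrict (Ioi (0 : ℝ))) := by
    have h := exp_neg_integrableOn_Ioi 0 hν
    refine h.congr_fun (fun t _ => ?_) measurableSet_Ioi
    simp only [neg_mul]
  have hWint : Integrable W (volume.restrict cell) := fgr_integrableOn_cell hW
  have hint : Integrable (Function.uncurry fun (t : ℝ) (k : Fin 3 → ℝ) =>
      Real.exp (-(ν * t)) * (W k * Real.cos (t * Ω k)))
      ((volume.restrict (Ioi (0 : ℝ))).prod (volume.restrict cell)) := by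
    have h1 : Integrable (fun z : ℝ × (Fin 3 → ℝ) => Real.exp (-(ν * z.1)) * ‖W z.2‖)
        ((volume.restrict (Ioi (0 : ℝ))).prod (volume.restrict cell)) := hexp.mul_prod hWint.norm
    refine h1.mono' (Continuous.aestronglyMeasurable (by fun_prop)) (ae_of_all _ (fun z => ?_))
    obtain ⟨t, k⟩ := z
    simp only [Function.uncurry_apply_pair, norm_mul, Real.norm_eq_abs, Real.abs_exp]
    exact mul_le_mul_of_nonneg_left (mul_le_of_le_one_right (abs_nonneg _) (Real.abs_cos_le_one _))
      (Real.exp_pos _).le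
  calc ∫ t in Ioi (0 : ℝ), Real.exp (-(ν * t)) * ∫ k in cell, W k * Real.cos (t * Ω k)
      = ∫ t in Ioi (0 : ℝ), ∫ k in cell, Real.exp (-(ν * t)) * (W k * Real.cos (t * Ω k)) := by
        refine setIntegral_congr_fun measurableSet_Ioi (fun t _ => ?_)
        exact (integral_const_mul _ _).symm
    _ = ∫ k in cell, ∫ t in Ioi (0 : ℝ), Real.exp (-(ν * t)) * (W k * Real.cos (t * Ω k)) :=
        integral_integral_swap hint
    _ = ∫ k in cell, W k * (ν / (ν ^ 2 + Ω k ^ 2)) := by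
        refine integral_congr_ae (ae_of_all _ (fun k => ?_))
        have h := Literature.Analysis.SpecialFunctions.integral_exp_neg_mul_cos hν (Ω k)
        calc ∫ t in Ioi (0 : ℝ), Real.exp (-(ν * t)) * (W k * Real.cos (t * Ω k))
            = W k * ∫ t in Ioi (0 : ℝ), Real.exp (-(ν * t)) * Real.cos (Ω k * t) := by
              rw [← integral_const_mul]
              refine setIntegral_congr_fun measurableSet_Ioi (fun t _ => ?_)
              rw [mul_comm t (Ω k)]; ring
          _ = W k * (ν / (ν ^ 2 + Ω k ^ 2)) := by rw [h]

/-! ### §3 The Abelian Fermi-golden-rule identity (unconditional) -/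

/-- `4π/alsPrefactor = 64π²/9` (`alsPrefactor = 9/(16π)`). [folklore] -/
theorem fgr_four_pi_div_alsPrefactor : 4 * Real.pi / alsPrefactor = 64 * Real.pi ^ 2 / 9 := by
  unfold alsPrefactor
  have hπ : Real.pi ≠ 0 := Real.pi_ne_zero
  field_simp
  ring

/-- **The Abelian Fermi golden rule for the free odd excursion kernel** (unconditional): for
`ω₂ > 0`, couplings `a, b` and a `2π`-periodic `C²` profile `f`,
`∫₀^∞ e^{−νt} F_f(t) dt → (64π²/9)·q_{ω₂,a,b}(f)` as `ν ↓ 0`, where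
`F_f(t) = ∫_{(−π,π]³} Φ²[f]²(∏ω)⁻² cos(tΩ) dk` is the kernel of stub B and `q = boltzmannForm`.
For `ν > 0` the Abel mean IS the sibling crux's `R_f(ν, 0)` (Fubini, §2, and the reindexing of §1),
and `R_f(ν,0) → (4π/alsPrefactor)·q(f)` is `MourreDissolution.fermiGoldenRule_threshold`.
[cite: AokiLukkarinenSpohn2006, eqs. (3.17)-(3.20), (4.10)-(4.11), (4.16)] -/
theorem tendsto_abel_freeOddExcursionKernel (ω₂ a b : ℝ) (hω : 0 < ω₂) (f : ℝ → ℝ)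
    (hper : Function.Periodic f (2 * Real.pi)) (hf : ContDiff ℝ 2 f) :
    Tendsto (fun ν : ℝ => ∫ t in Set.Ioi (0 : ℝ), Real.exp (-(ν * t)) *
        ∫ k in Set.pi Set.univ (fun _ : Fin 3 => Set.Ioc (-Real.pi) Real.pi),
          vertex a b (k 0) (k 1) (k 2) ^ 2 *
            (f (k 0) + f (k 1) - f (k 2) - f (k 0 + k 1 - k 2)) ^ 2 /
            (dispersion ω₂ (k 0) * dispersion ω₂ (k 1) * dispersion ω₂ (k 2) *
              dispersion ω₂ (k 0 + k 1 - k 2)) ^ 2 *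
            Real.cos (t * resonanceFn ω₂ (k 0) (k 1) (k 2)))
      (𝓝[>] (0 : ℝ)) (𝓝 ((64 * Real.pi ^ 2 / 9) * (boltzmannForm ω₂ a b f).toReal)) := by
  have hfc : Continuous f := hf.continuous
  -- the weight and the resonance function as continuous functions on `Fin 3 → ℝ`
  set W : (Fin 3 → ℝ) → ℝ := fun k => vertex a b (k 0) (k 1) (k 2) ^ 2 *
      (f (k 0) + f (k 1) - f (k 2) - f (k 0 + k 1 - k 2)) ^ 2 /
      (dispersion ω₂ (k 0) * dispersion ω₂ (k 1) * dispersion ω₂ (k 2) *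
        dispersion ω₂ (k 0 + k 1 - k 2)) ^ 2 with hWdef
  set Ω : (Fin 3 → ℝ) → ℝ := fun k => resonanceFn ω₂ (k 0) (k 1) (k 2) with hΩdef
  have hden : ∀ k : Fin 3 → ℝ, (dispersion ω₂ (k 0) * dispersion ω₂ (k 1) * dispersion ω₂ (k 2) *
      dispersion ω₂ (k 0 + k 1 - k 2)) ^ 2 ≠ 0 := fun k =>
    pow_ne_zero _ (mul_pos (mul_pos (mul_pos (dispersion_pos hω _) (dispersion_pos hω _))
      (dispersion_pos hω _)) (dispersion_pos hω _)).ne'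
  have hW : Continuous W := by
    have h1 : Continuous fun k : Fin 3 → ℝ => vertex a b (k 0) (k 1) (k 2) ^ 2 *
        (f (k 0) + f (k 1) - f (k 2) - f (k 0 + k 1 - k 2)) ^ 2 := by fun_prop
    have h2 : Continuous fun k : Fin 3 → ℝ => (dispersion ω₂ (k 0) * dispersion ω₂ (k 1) *
        dispersion ω₂ (k 2) * dispersion ω₂ (k 0 + k 1 - k 2)) ^ 2 := by fun_prop
    exact h1.div h2 hden
  have hΩ : Continuous Ω := by rw [hΩdef]; fun_prop
  -- rewrite the Abel means through Fubini (eventually in `ν > 0`)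
  have hev : ∀ᶠ ν in 𝓝[>] (0 : ℝ),
      ∫ k in Set.pi Set.univ (fun _ : Fin 3 => Set.Ioc (-Real.pi) Real.pi), W k * (ν / (ν ^ 2 + Ω k ^ 2)) =
        ∫ t in Set.Ioi (0 : ℝ), Real.exp (-(ν * t)) *
          ∫ k in Set.pi Set.univ (fun _ : Fin 3 => Set.Ioc (-Real.pi) Real.pi), W k * Real.cos (t * Ω k) := by
    filter_upwards [self_mem_nhdsWithin] with ν hν
    exact (fgr_abel_eq_poisson hW hΩ hν).symm
  refine Tendsto.congr' hev ?_
  -- the sibling's threshold limit, transported to the box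
  have hfgr := MourreDissolution.fermiGoldenRule_threshold ω₂ a b hω f hper hf
  rw [fgr_four_pi_div_alsPrefactor] at hfgr
  refine hfgr.congr' ?_
  filter_upwards [self_mem_nhdsWithin] with ν hν
  have hν' : 0 < ν := hν
  -- both sides are the integral of one continuous function over the cell
  set G : ℝ × ℝ × ℝ → ℝ := fun p => vertex a b p.1 p.2.2 p.2.1 ^ 2 /
      (dispersion ω₂ p.1 * dispersion ω₂ p.2.2 * dispersion ω₂ p.2.1 *
        dispersion ω₂ (p.1 + p.2.2 - p.2.1)) ^ 2 *
      (f p.1 + f p.2.2 - f p.2.1 - f (p.1 + p.2.2 - p.2.1)) ^ 2 *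
      (ν / (resonanceFn ω₂ p.1 p.2.2 p.2.1 ^ 2 + ν ^ 2)) with hGdef
  have hdenp : ∀ p : ℝ × ℝ × ℝ, (dispersion ω₂ p.1 * dispersion ω₂ p.2.2 * dispersion ω₂ p.2.1 *
      dispersion ω₂ (p.1 + p.2.2 - p.2.1)) ^ 2 ≠ 0 := fun p =>
    pow_ne_zero _ (mul_pos (mul_pos (mul_pos (dispersion_pos hω _) (dispersion_pos hω _))
      (dispersion_pos hω _)) (dispersion_pos hω _)).ne'
  have hG : Continuous G := by
    have h1 : Continuous fun p : ℝ × ℝ × ℝ => vertex a b p.1 p.2.2 p.2.1 ^ 2 := by fun_prop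
    have h2 : Continuous fun p : ℝ × ℝ × ℝ => (dispersion ω₂ p.1 * dispersion ω₂ p.2.2 *
        dispersion ω₂ p.2.1 * dispersion ω₂ (p.1 + p.2.2 - p.2.1)) ^ 2 := by fun_prop
    have h3 : Continuous fun p : ℝ × ℝ × ℝ =>
        (f p.1 + f p.2.2 - f p.2.1 - f (p.1 + p.2.2 - p.2.1)) ^ 2 := by fun_prop
    have h4 : Continuous fun p : ℝ × ℝ × ℝ => ν / (resonanceFn ω₂ p.1 p.2.2 p.2.1 ^ 2 + ν ^ 2) :=
      continuous_const.div (by fun_prop) fun p => by positivity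
    exact ((h1.div h2 hdenp).mul h3).mul h4
  have hiter := MourreDissolution.levelShift_integral_cell hG
  have hbox := fgr_setIntegral_cell_eq G (Set.Ioc (-Real.pi) Real.pi)
  calc (∫ k₁ in Set.Ioc (-Real.pi) Real.pi, ∫ k₃ in Set.Ioc (-Real.pi) Real.pi,
          ∫ k₂ in Set.Ioc (-Real.pi) Real.pi,
            vertex a b k₁ k₂ k₃ ^ 2 /
                (dispersion ω₂ k₁ * dispersion ω₂ k₂ * dispersion ω₂ k₃ * dispersion ω₂ (k₁ + k₂ - k₃)) ^ 2 *
              (f k₁ + f k₂ - f k₃ - f (k₁ + k₂ - k₃)) ^ 2 *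
              (ν / (resonanceFn ω₂ k₁ k₂ k₃ ^ 2 + ν ^ 2)))
      = ∫ p, G p ∂((volume.restrict (Set.Ioc (-Real.pi) Real.pi)).prod
          ((volume.restrict (Set.Ioc (-Real.pi) Real.pi)).prod
            (volume.restrict (Set.Ioc (-Real.pi) Real.pi)))) := hiter
    _ = ∫ k in Set.pi Set.univ (fun _ : Fin 3 => Set.Ioc (-Real.pi) Real.pi), G (k 0, k 2, k 1) :=
          hbox.symm
    _ = ∫ k in Set.pi Set.univ (fun _ : Fin 3 => Set.Ioc (-Real.pi) Real.pi), W k * (ν / (ν ^ 2 + Ω k ^ 2)) := by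
          refine integral_congr_ae (ae_of_all _ (fun k => ?_))
          simp only [hGdef, hWdef, hΩdef]
          rw [add_comm (resonanceFn ω₂ (k 0) (k 1) (k 2) ^ 2) (ν ^ 2)]
          ring

/-! ### §4 From integrability to the value of `∫₀^∞ F_f` -/

/-- **Abel summation for an integrable function** : if `F ∈ L¹(0,∞)` then
`∫₀^∞ e^{−νt} F(t) dt → ∫₀^∞ F` as `ν ↓ 0` (dominated convergence, `0 ≤ e^{−νt} ≤ 1`). [folklore] -/
theorem fgr_tendsto_abel_of_integrableOn {F : ℝ → ℝ} (hF : IntegrableOn F (Set.Ioi 0)) :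
    Tendsto (fun ν : ℝ => ∫ t in Set.Ioi (0 : ℝ), Real.exp (-(ν * t)) * F t)
      (𝓝[>] (0 : ℝ)) (𝓝 (∫ t in Set.Ioi (0 : ℝ), F t)) := by
  have hlim : Tendsto (fun ν : ℝ => ∫ t in Set.Ioi (0 : ℝ), Real.exp (-(ν * t)) * F t)
      (𝓝[>] (0 : ℝ)) (𝓝 (∫ t in Set.Ioi (0 : ℝ), Real.exp (-(0 * t)) * F t)) := by
    refine tendsto_integral_filter_of_dominated_convergence (fun t => ‖F t‖) ?_ ?_ hF.norm ?_
    · filter_upwards [self_mem_nhdsWithin] with ν _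
      exact ((by fun_prop : Continuous fun t : ℝ => Real.exp (-(ν * t))).aestronglyMeasurable).mul
        hF.aestronglyMeasurable
    · filter_upwards [self_mem_nhdsWithin] with ν hν
      rw [ae_restrict_iff' measurableSet_Ioi]
      refine ae_of_all _ (fun t ht => ?_)
      rw [norm_mul, Real.norm_eq_abs, Real.abs_exp]
      refine mul_le_of_le_one_left (norm_nonneg _) ?_
      rw [Real.exp_le_one_iff]
      have : 0 ≤ ν * t := mul_nonneg (le_of_lt hν) (le_of_lt ht)
      linarith
    · refine ae_of_all _ (fun t => ?_)
      refine ((Continuous.tendsto ?_ 0).mono_left nhdsWithin_le_nhds)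
      fun_prop
  simpa only [zero_mul, neg_zero, Real.exp_zero, one_mul] using hlim

/-- **The Fermi-golden-rule identity from integrability.** If the free odd excursion kernel `F_f` of a
`2π`-periodic `C²` profile `f` is integrable on `(0,∞)`, then `∫₀^∞ F_f = (64π²/9)·q_{ω₂,a,b}(f)`.
[cite: AokiLukkarinenSpohn2006, eqs. (3.17)-(3.20), (4.10)-(4.11), (4.16)] -/
theorem integral_freeOddExcursionKernel_of_integrableOn (ω₂ a b : ℝ) (hω : 0 < ω₂) (f : ℝ → ℝ)
    (hper : Function.Periodic f (2 * Real.pi)) (hf : ContDiff ℝ 2 f)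
    (hint : IntegrableOn (fun t : ℝ => ∫ k in Set.pi Set.univ (fun _ : Fin 3 => Set.Ioc (-Real.pi) Real.pi),
          vertex a b (k 0) (k 1) (k 2) ^ 2 *
            (f (k 0) + f (k 1) - f (k 2) - f (k 0 + k 1 - k 2)) ^ 2 /
            (dispersion ω₂ (k 0) * dispersion ω₂ (k 1) * dispersion ω₂ (k 2) *
              dispersion ω₂ (k 0 + k 1 - k 2)) ^ 2 *
            Real.cos (t * resonanceFn ω₂ (k 0) (k 1) (k 2))) (Set.Ioi 0)) :
    ∫ t in Set.Ioi (0 : ℝ), (∫ k in Set.pi Set.univ (fun _ : Fin 3 => Set.Ioc (-Real.pi) Real.pi),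
          vertex a b (k 0) (k 1) (k 2) ^ 2 *
            (f (k 0) + f (k 1) - f (k 2) - f (k 0 + k 1 - k 2)) ^ 2 /
            (dispersion ω₂ (k 0) * dispersion ω₂ (k 1) * dispersion ω₂ (k 2) *
              dispersion ω₂ (k 0 + k 1 - k 2)) ^ 2 *
            Real.cos (t * resonanceFn ω₂ (k 0) (k 1) (k 2))) =
        (64 * Real.pi ^ 2 / 9) * (boltzmannForm ω₂ a b f).toReal :=
  tendsto_nhds_unique (fgr_tendsto_abel_of_integrableOn hint)
    (tendsto_abel_freeOddExcursionKernel ω₂ a b hω f hper hf)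

/-! ### §5 Sine polynomials are admissible profiles -/

/-- A sine polynomial `Σ_{i<M} c_i sin((i+1)k)` is `2π`-periodic. [folklore] -/
theorem fgr_periodic_sinePoly (M : ℕ) (c : Fin M → ℝ) :
    Function.Periodic (fun k : ℝ => ∑ i, c i * Real.sin (((i : ℕ) + 1 : ℕ) * k)) (2 * Real.pi) := by
  intro k
  refine Finset.sum_congr rfl (fun i _ => ?_)
  have h : (((i : ℕ) + 1 : ℕ) : ℝ) * (k + 2 * Real.pi) =
      ((i : ℕ) + 1 : ℕ) * k + ((i : ℕ) + 1 : ℕ) * (2 * Real.pi) := by ring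
  rw [h, Real.sin_add_nat_mul_two_pi]

/-- A sine polynomial is smooth (in particular `C²`). [folklore] -/
theorem fgr_contDiff_sinePoly (M : ℕ) (c : Fin M → ℝ) (n : ℕ) :
    ContDiff ℝ n (fun k : ℝ => ∑ i, c i * Real.sin (((i : ℕ) + 1 : ℕ) * k)) := by
  refine ContDiff.sum (fun i _ => ?_)
  exact contDiff_const.mul (Real.contDiff_sin.comp (contDiff_const.mul contDiff_id))

/-! ### §6 The reshaped stub: B follows from its `L¹` clause -/

/-- **Stub B of line `kinetic-polymer-gas-on-the-time-axis` from its integrability clause alone**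
(lead c11 reshape `B ⇐ B_int`): if for all `ω₂ > 0`, `a, b` and every sine polynomial `f` the free
odd excursion kernel `F_f` is integrable on `(0,∞)` (the dispersive / stationary-phase half, open as
formalisation), then stub B holds verbatim — the Fermi-golden-rule clause
`∫₀^∞ F_f = (64π²/9)·q(f)` being `integral_freeOddExcursionKernel_of_integrableOn`.
[cite: AokiLukkarinenSpohn2006, eqs. (3.17)-(3.20), (4.10)-(4.11), (4.16)] -/
theorem stub_freeOddExcursionKernel_of_integrable : (∀ ω₂ a b : ℝ, 0 < ω₂ → ∀ f : ℝ → ℝ, (∃ (M : ℕ) (c : Fin M → ℝ), f = fun k => ∑ i, c i * Real.sin (((i : ℕ) + 1 : ℕ) * k)) → MeasureTheory.IntegrableOn (fun t : ℝ => ∫ k in Set.pi Set.univ (fun _ : Fin 3 => Set.Ioc (-Real.pi) Real.pi), Literature.MathematicalPhysics.KineticTheory.PhononBoltzmann.vertex a b (k 0) (k 1) (k 2) ^ 2 * (f (k 0) + f (k 1) - f (k 2) - f (k 0 + k 1 - k 2)) ^ 2 / (Literature.MathematicalPhysics.KineticTheory.PhononBoltzmann.dispersion ω₂ (k 0) * Literature.MathematicalPhysics.KineticTheory.PhononBoltzmann.dispersion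 ω₂ (k 1) * Literature.MathematicalPhysics.KineticTheory.PhononBoltzmann.dispersion ω₂ (k 2) * Literature.MathematicalPhysics.KineticTheory.PhononBoltzmann.dispersion ω₂ (k 0 + k 1 - k 2)) ^ 2 * Real.cos (t * Literature.MathematicalPhysics.KineticTheory.PhononBoltzmann.resonanceFn ω₂ (k 0) (k 1) (k 2))) (Set.Ioi 0)) → ∀ ω₂ a b : ℝ, 0 < ω₂ → ∀ f : ℝ → ℝ, (∃ (M : ℕ) (c : Fin M → ℝ), f = fun k => ∑ i, c i * Real.sin (((i : ℕ) + 1 : ℕ) * k)) → MeasureTheory.IntegrableOn (fun t : ℝ => ∫ k in Set.pi Set.univ (fun _ : Fin 3 => Set.Ioc (-Real.pi) Real.pi), Literature.MathematicalPhysics.KineticTheory.PhononBoltzmann.vertex a b (k 0) (k 1) (k 2) ^ 2 * (f (k 0) + f (k 1) - f (k 2) - f (k 0 + k 1 - k 2)) ^ 2 / (Literature.MathematicalPhysics.KineticTheory.PhononBoltzmann.dispersion ω₂ (k 0) * Literature.MathematicalPhysics.KineticTheory.PhononBoltzmann.dispersion ω₂ (k 1) * Literature.MathematicalPhysics.KineticTheory.PhononBoltzmann.dispersion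 ω₂ (k 2) * Literature.MathematicalPhysics.KineticTheory.PhononBoltzmann.dispersion ω₂ (k 0 + k 1 - k 2)) ^ 2 * Real.cos (t * Literature.MathematicalPhysics.KineticTheory.PhononBoltzmann.resonanceFn ω₂ (k 0) (k 1) (k 2))) (Set.Ioi 0) ∧ ∫ t in Set.Ioi (0 : ℝ), (∫ k in Set.pi Set.univ (fun _ : Fin 3 => Set.Ioc (-Real.pi) Real.pi), Literature.MathematicalPhysics.KineticTheory.PhononBoltzmann.vertex a b (k 0) (k 1) (k 2) ^ 2 * (f (k 0) + f (k 1) - f (k 2) - f (k 0 + k 1 - k 2)) ^ 2 / (Literature.MathematicalPhysics.KineticTheory.PhononBoltzmann.dispersion ω₂ (k 0) * Literature.MathematicalPhysics.KineticTheory.PhononBoltzmann.dispersion ω₂ (k 1) * Literature.MathematicalPhysics.KineticTheory.PhononBoltzmann.dispersion ω₂ (k 2) * Literature.MathematicalPhysics.KineticTheory.PhononBoltzmann.dispersion ω₂ (k 0 + k 1 - k 2)) ^ 2 * Real.cos (t * Literature.MathematicalPhysics.KineticTheory.PhononBoltzmann.resonanceFn ω₂ (k 0) (k 1) (k 2)))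 = (64 * Real.pi ^ 2 / 9) * (Literature.MathematicalPhysics.KineticTheory.PhononBoltzmann.boltzmannForm ω₂ a b f).toReal := by
  intro hint ω₂ a b hω f hf
  refine ⟨hint ω₂ a b hω f hf, ?_⟩
  obtain ⟨M, c, hfMc⟩ := hf
  have hper : Function.Periodic f (2 * Real.pi) := by rw [hfMc]; exact fgr_periodic_sinePoly M c
  have hcd : ContDiff ℝ 2 f := by rw [hfMc]; exact fgr_contDiff_sinePoly M c 2
  exact integral_freeOddExcursionKernel_of_integrableOn ω₂ a b hω f hper hcd
    (hint ω₂ a b hω f ⟨M, c, hfMc⟩)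

end Summit.AtomisticToContinuum.FouriersLaw.Theorems.DrudeDissolution.KineticPolymerGasOnTheTimeAxis

end
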